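import Summits.Ventures.PercRepro.PuncturedLYMAllJDeletion
import Summits.Ventures.PercRepro.ProfilePointedAvoidRowUpset
import Summits.Ventures.PercRepro.ProfileBiIndepNormCons

/-!
# PercRepro — (D-gen) AND (D) FOR EVERY SPARSE PAVING MATROID: THE NORMALISED STEP OF THE BI-INDEPENDENT PROFILE IS
A BINOMIAL FACT THERE (p10, gen 33)

The gen-29 bridge `avoidRowUpset_of_normCons_of_fact` derives (D-gen) from (NC) and the named fact
`BiIndepDensityLogConcave` through its consequence `(n − k)·P_k ≤ (k + 1)·P_{k+1}` for `2k + 1 ≤ n` (Theorem A's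
normalised step).  For a sparse paving matroid with `n ≤ 2r − 2` that step is unconditional: below the bottom level
`P_k = 0`; from the bottom level on every `(k+1)`-subset is bi-independent (`k + 1 ≤ r − 1` and `n − k − 1 ≤ r − 1`),
so `P_{k+1} = C(n, k+1)`, while `P_k ≤ C(n, k)` and `(n − k)·C(n, k) = (k + 1)·C(n, k+1)` (`density_step_of_sparsePaving`).
* `AvoidRowUpsetAt` — (D-gen) at one matroid; `avoidRowUpsetAt_of_normConsAt_of_step` — the gen-29 proof at one
  matroid, with the step as a hypothesis;
* **`avoidRowUpsetAt_of_sparsePaving`** — (D-gen) for every sparse paving matroid with `r + 1 ≤ n ≤ 2r − 2` (Theorem G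
  gives (NC), on any ground set);
* **`avoidRowAt_of_sparsePaving`** — (D) at every point of every sparse paving matroid with `r + 2 ≤ n ≤ 2r − 2`
  (the deletion stays sparse paving, gen 32; (D-gen) at the modular cut of `p`).
With gen 32's (H-gen), (PM-flat), (H), (C1″) the whole pointed line of S5 holds unconditionally on the class of sparse
paving matroids in the range.  Nothing here asserts any conjecture in general.
-/

open scoped Matroid

namespace PercRepro.Cogirth

open Finset ThmH Skew

variable {α : Type} [DecidableEq α] {M : Matroid α} [M.Finite]

/-- **(D-gen) at one matroid**: for every up-set `U` of flats and `2k + 1 ≤ n`,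
`(n − k)·avoidUpCount M U k ≤ (k + 1)·avoidUpCount M U (k + 1)`. -/
def AvoidRowUpsetAt (M : Matroid α) [M.Finite] : Prop :=
  ∀ (U : Finset (Finset α)), UpFlats M U → ∀ k : ℕ, 2 * k + 1 ≤ (gr M).card →
    ((gr M).card - k) * avoidUpCount M U k ≤ (k + 1) * avoidUpCount M U (k + 1)

/-- **Theorem A's normalised step is a binomial fact for sparse paving matroids** (`n + 2 ≤ 2r`, `2k + 1 ≤ n`):
`(n − k)·P_k ≤ (k + 1)·P_{k+1}`. -/
theorem density_step_of_sparsePaving {r : ℕ} (hsp : IsSparsePavingF M r) (hn : (gr M).card + 2 ≤ 2 * r)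
    {k : ℕ} (hk : 2 * k + 1 ≤ (gr M).card) :
    ((gr M).card - k) * (biIndepSets M k).card ≤ (k + 1) * (biIndepSets M (k + 1)).card := by
  have hr : r ≤ (gr M).card := by
    have := hsp.1 ▸ rk_le_card (gr M)
    omega
  rcases Nat.lt_or_ge (k + r) (gr M).card with hlt | hge
  · rw [biIndepSets_eq_empty_of_lt (by rw [hsp.1]; exact hlt), card_empty, mul_zero]
    exact Nat.zero_le _
  · have hfull : biIndepSets M (k + 1) = (gr M).powersetCard (k + 1) := by
      apply biIndepSets_eq_powersetCard_of_indep_of_indep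
      · intro S hS hSc
        exact rk_eq_card_of_card_lt_of_sparsePaving hsp hr hS (by omega)
      · intro S hS hSc
        exact rk_eq_card_of_card_lt_of_sparsePaving hsp hr hS (by omega)
    have hle : (biIndepSets M k).card ≤ (gr M).card.choose k := by
      rw [← card_powersetCard k (gr M)]
      apply card_le_card
      intro X hX
      rw [mem_powersetCard]
      exact ⟨(mem_biIndepSets.1 hX).1, (mem_biIndepSets.1 hX).2.1⟩
    have hch := Nat.choose_succ_right_eq (gr M).card k
    rw [hfull, card_powersetCard]
    calc ((gr M).card - k) * (biIndepSets M k).card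
        ≤ ((gr M).card - k) * (gr M).card.choose k := Nat.mul_le_mul_left _ hle
      _ = (gr M).card.choose k * ((gr M).card - k) := mul_comm _ _
      _ = (gr M).card.choose (k + 1) * (k + 1) := hch.symm
      _ = (k + 1) * (gr M).card.choose (k + 1) := mul_comm _ _

/-- **(NC) at one matroid + the normalised step ⟹ (D-gen) at that matroid** (the gen-29 proof, one matroid). -/
theorem avoidRowUpsetAt_of_normConsAt_of_step
    (hA : ∀ k : ℕ, 2 * k + 1 ≤ (gr M).card →
      ((gr M).card - k) * (biIndepSets M k).card ≤ (k + 1) * (biIndepSets M (k + 1)).card)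
    (h : NormConsAt M) : AvoidRowUpsetAt M := by
  intro U hU k hk
  have e1 := avoidUpCount_add_card_filter_clF_mem_mirror (M := M) U (k := k) (by omega)
  have e2 := avoidUpCount_add_card_filter_clF_mem_mirror (M := M) U (k := k + 1) (by omega)
  have hs := h U hU ((gr M).card - (k + 1))
  unfold NormConsStep upCount at hs
  rw [show (gr M).card - (k + 1) + 1 = (gr M).card - k by omega] at hs
  have hsymm1 := card_biIndepSets_symm M (k := k) (by omega)
  have hsymm2 := card_biIndepSets_symm M (k := k + 1) (by omega)
  rw [← hsymm1, ← hsymm2] at hs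
  have hA' := hA k hk
  set Fk := avoidUpCount M U k with hFk
  set Fk1 := avoidUpCount M U (k + 1) with hFk1
  set P0 := (biIndepSets M k).card with hP0
  set P1 := (biIndepSets M (k + 1)).card with hP1
  set u' := ((biIndepSets M ((gr M).card - k)).filter (fun X => clF M X ∈ U)).card with hu'
  set u'' := ((biIndepSets M ((gr M).card - (k + 1))).filter (fun X => clF M X ∈ U)).card with hu''
  have key : Fk * P1 ≤ Fk1 * P0 := by
    have h1 : (Fk + u') * P1 = P0 * P1 := by rw [e1]
    have h2 : (Fk1 + u'') * P0 = P1 * P0 := by rw [e2]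
    rw [add_mul] at h1 h2
    nlinarith [h1, h2, hs, Nat.mul_comm P0 P1]
  rcases Nat.eq_zero_or_pos P1 with h0 | hpos
  · have hP0' : P0 = 0 := by
      by_contra hne
      have := card_biIndepSets_pos_of_pos (M := M) (k := k) (j := k + 1) (by omega) (by omega)
        (Nat.pos_of_ne_zero hne)
      omega
    have hF0 : Fk = 0 := by
      have := card_filter_le (biIndepSets M k) (fun X => clF M (gr M \ X) ∉ U)
      unfold avoidUpCount at hFk
      omega
    rw [hF0]
    simp
  · have h3 : ((gr M).card - k) * Fk * P1 ≤ (k + 1) * Fk1 * P1 := by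
      calc ((gr M).card - k) * Fk * P1 = ((gr M).card - k) * (Fk * P1) := by ring
        _ ≤ ((gr M).card - k) * (Fk1 * P0) := Nat.mul_le_mul_left _ key
        _ = (((gr M).card - k) * P0) * Fk1 := by ring
        _ ≤ ((k + 1) * P1) * Fk1 := Nat.mul_le_mul_right _ hA'
        _ = (k + 1) * Fk1 * P1 := by ring
    exact Nat.le_of_mul_le_mul_right h3 hpos

/-- **(D-gen) FOR EVERY SPARSE PAVING MATROID** with `r + 1 ≤ n ≤ 2r − 2`, on any ground set. -/
theorem avoidRowUpsetAt_of_sparsePaving {r : ℕ} (hsp : IsSparsePavingF M r) (hr1 : r + 1 ≤ (gr M).card)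
    (hn : (gr M).card + 2 ≤ 2 * r) : AvoidRowUpsetAt M :=
  avoidRowUpsetAt_of_normConsAt_of_step (fun _ hk => density_step_of_sparsePaving hsp hn hk)
    (normConsAt_of_sparsePaving_all hsp hr1 hn)

/-- **(D) AT EVERY POINT OF EVERY SPARSE PAVING MATROID** with `r + 2 ≤ n ≤ 2r − 2`:
`(n − k − 1)·out_k ≤ (k + 1)·out_{k+1}` for `2k + 2 ≤ n`. -/
theorem avoidRowAt_of_sparsePaving {r : ℕ} (hsp : IsSparsePavingF M r) (hr2 : r + 2 ≤ (gr M).card)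
    (hn : (gr M).card + 2 ≤ 2 * r) {p : α} (hp : p ∈ gr M) : AvoidRowAt M p := by
  intro k hk
  have hN := card_gr_delete (M := M) hp
  have hsp' := isSparsePavingF_delete hsp hr2 hp
  have h1 := avoidRowUpsetAt_of_sparsePaving hsp' (by rw [hN]; omega) (by rw [hN]; omega) (modCut M p)
    (upFlats_modCut p) k (by rw [hN]; omega)
  rw [avoidUpCount_modCut_eq_outCount hp, avoidUpCount_modCut_eq_outCount hp, hN] at h1
  rwa [show (gr M).card - k - 1 = (gr M).card - 1 - k by omega]

end PercRepro.Cogirth
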